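import Summits.BirchSwinnertonDyer.BirchSwinnertonDyer.Theorems.ManinLocalTwoThreeManinConstantFiftySix
import HarnessLib

/-!
# Level 56: `N(56a1) = N(56b1) = 56` by kernel Tate certificates, and the `X₀(56)`-domain of C2 is inhabited under modularity

Cell bsd-f2-manin, route `ManinLocalTwoThree` (crux C2 `ManinOddAtFour`, stmt-22967: `2² ∣ 56`), prover seat p2 gen 28; non-vacuity companion
of `ManinConstantFiftySix` (`|c| = 1 ∧ 2 ∤ c` on `X₀(56)`, unconditional).

* §1 **`N([0,0,0,1,2]) = 56`**: deep Tate certificate at `2` — change `(r, s, t) = (1, 1, 2)` to `[2, 2, 4, 0, 0]`, exit `I₁*` (`2 ∥ a₂`, `4 ∣ a₃`,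
  `8 ∣ a₄`, `16 ∣ a₆`, `(a₃/4)² + 4a₆/16` odd; `f₂ = v₂(Δ) + 1 − 6 = 3`), good at `3`, non-split multiplicative at `7`;
  **`N([0,−1,0,0,−4]) = 56`**: deep Tate certificate at `2` — `(r, s, t) = (2, 1, 0)` to `[2, 4, 0, 8, 0]`, exit `III*` (`4 ∣ a₂`, `8 ∣ a₃`, `8 ∥ a₄`,
  `32 ∣ a₆`; `f₂ = 10 + 1 − 8 = 3`), good at `3`, split multiplicative at `7` (node-tangent root `t = 1`).  All kernel-checked (`decide +kernel`).
* §2 CONDITIONAL on the item's own binder `exists_isNewformOf` (Modularity): both curves have a newform in `S₂(Γ₀(56))`, and a lattice-optimal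
  `X₀(56)`-datum on a globally minimal model in the class `56a` exists — C2's `∀`-domain at `N = 56` is inhabited relative to the item's hypotheses.

No definition, no named fact, no sorry; §1 unconditional, §2 conditional on `exists_isNewformOf` only.  Nothing here proves C2, Manin's conjecture
or BSD. [cite: Silverman1994, IV.9.4] [cite: CremonaAlgorithms1997, Table 1 (56a1, 56b1)] [cite: DiamondShurman2005, Thm. 8.8.3]
-/

set_option autoImplicit false
-- lint-debt: the directory name repeats the summit name (sibling precedent `ManinLocalTwoThreeEtaIdentitiesForty.lean`)
set_option linter.dupNamespace false

noncomputable section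

open Complex
open scoped MatrixGroups ModularForm
open ModularForm CongruenceSubgroup WeierstrassCurve
open Summit.BirchSwinnertonDyer.Rank1Residual.Additive
open Literature.NumberTheory.Automorphic
open Literature.NumberTheory.EllipticCurves Literature.NumberTheory.EllipticCurves.ModularForms

namespace Summit.BirchSwinnertonDyer.BirchSwinnertonDyer.Theorems.ManinLocalTwoThree.NonVacuityFiftySix

open ManinConstantFiftySix

/-! ## §1 The conductors `N(56a1) = N(56b1) = 56` -/

/-- **`N([0, 0, 0, 1, 2]) = 56 = 2³·7`**: deep Tate certificate at `2` (`(r,s,t) = (1,1,2)`, exit `I₁*`, `f₂ = 3`), good at `3`, non-split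
multiplicative at `7`; kernel-checked. [cite: Silverman1994, IV.9.4] [cite: CremonaAlgorithms1997, Table 1 (56a1)] -/
theorem conductorNorm_fiftySixA1 : (⟨0, 0, 0, 1, 2⟩ : WeierstrassCurve ℚ).conductorNorm ℤ = 56 := by
  rw [mk_fiftySixA1_eq_cast]
  exact IntModelCond.conductorNorm_mk_eq_of_certs_of_eq 0 0 0 1 2
    (cm := ⟨8, 4, 6, [⟨7, 2, 1, 0, 0⟩]⟩) (c := ⟨8, 4, 6, 0, 1, 3, [⟨7, 2, 1, 0, 0⟩]⟩)
    (l₂ := ⟨3, 1, 1, 2, 8, 71, 0⟩) (l₃ := ⟨0, 0, 0, 0, 0, 0, 0⟩)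
    (by decide +kernel) (by decide +kernel) (by decide +kernel) (by decide +kernel) (by decide +kernel)

/-- **`N([0, −1, 0, 0, −4]) = 56 = 2³·7`**: deep Tate certificate at `2` (`(r,s,t) = (2,1,0)`, exit `III*`, `f₂ = 3`), good at `3`, split
multiplicative at `7` (node-tangent root `t = 1`); kernel-checked. [cite: Silverman1994, IV.9.4] [cite: CremonaAlgorithms1997, Table 1 (56b1)] -/
theorem conductorNorm_fiftySixB1 : (⟨0, -1, 0, 0, -4⟩ : WeierstrassCurve ℚ).conductorNorm ℤ = 56 := by
  rw [mk_fiftySixB1_eq_cast]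
  exact IntModelCond.conductorNorm_mk_eq_of_certs_of_eq 0 (-1) 0 0 (-4)
    (cm := ⟨10, 4, 6, [⟨7, 2, 1, 1, 1⟩]⟩) (c := ⟨10, 4, 6, 0, 0, 0, [⟨7, 2, 1, 1, 1⟩]⟩)
    (l₂ := ⟨3, 2, 1, 0, 10, 9, 0⟩) (l₃ := ⟨0, 0, 0, 0, 0, 0, 0⟩)
    (by decide +kernel) (by decide +kernel) (by decide +kernel) (by decide +kernel) (by decide +kernel)

/-! ## §2 Under modularity: newforms of `56a1`, `56b1` in `S₂(Γ₀(56))` and an inhabited domain -/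

/-- **Modularity at `56a1`, levelled**: under `exists_isNewformOf` the curve `[0, 0, 0, 1, 2]` has a newform in `S₂(Γ₀(56))` (its conductor
IS `56`).  CONDITIONAL on the item's own binder `exists_isNewformOf`. [cite: DiamondShurman2005, Thm. 8.8.3] -/
theorem exists_isNewformOf_fiftySixA1 (hnf : exists_isNewformOf) :
    ∃ f : CuspForm (Gamma0 56) 2, IsNewformOf (⟨0, 0, 0, 1, 2⟩ : WeierstrassCurve ℚ) f := by
  haveI := isElliptic_fiftySixA1
  have key : ∀ (N : ℕ) [NeZero N], (⟨0, 0, 0, 1, 2⟩ : WeierstrassCurve ℚ).conductorNorm ℤ = N →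
      ∃ f : CuspForm (Gamma0 N) 2, IsNewformOf (⟨0, 0, 0, 1, 2⟩ : WeierstrassCurve ℚ) f := by
    intro N _ hN
    subst hN
    exact hnf _
  haveI : NeZero (56 : ℕ) := ⟨by decide⟩
  exact key 56 conductorNorm_fiftySixA1

/-- **Modularity at `56b1`, levelled**: under `exists_isNewformOf` the curve `[0, −1, 0, 0, −4]` has a newform in `S₂(Γ₀(56))`.
CONDITIONAL on `exists_isNewformOf`. [cite: DiamondShurman2005, Thm. 8.8.3] -/
theorem exists_isNewformOf_fiftySixB1 (hnf : exists_isNewformOf) :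
    ∃ f : CuspForm (Gamma0 56) 2, IsNewformOf (⟨0, -1, 0, 0, -4⟩ : WeierstrassCurve ℚ) f := by
  haveI := isElliptic_fiftySixB1
  have key : ∀ (N : ℕ) [NeZero N], (⟨0, -1, 0, 0, -4⟩ : WeierstrassCurve ℚ).conductorNorm ℤ = N →
      ∃ f : CuspForm (Gamma0 N) 2, IsNewformOf (⟨0, -1, 0, 0, -4⟩ : WeierstrassCurve ℚ) f := by
    intro N _ hN
    subst hN
    exact hnf _
  haveI : NeZero (56 : ℕ) := ⟨by decide⟩
  exact key 56 conductorNorm_fiftySixB1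

/-- **A lattice-optimal `X₀(56)`-datum on a globally minimal model in the class `56a` exists under modularity**, i.e. C2's `∀`-domain at `N = 56`
is inhabited relative to the item's hypotheses, and the datum has `|c| = 1`; CONDITIONAL on `exists_isNewformOf` only.
[cite: EdixhovenManin1991, Prop. 2] -/
theorem maninOddAtFour_domain_inhabited_fiftySix_of_modularity (hnf : exists_isNewformOf) :
    ∃ (W₀ : WeierstrassCurve ℚ) (_ : W₀.IsElliptic) (_ : W₀.IsGloballyMinimal) (D₀ : ModularParametrizationData W₀ 56),
      (⟨0, 0, 0, 1, 2⟩ : WeierstrassCurve ℚ).IsIsogenous W₀ ∧ (∀ z ∈ D₀.L.lattice, ∃ w ∈ periodLattice D₀.f, z = D₀.c * w) ∧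
      |D₀.maninConstant| = 1 ∧ 2 ^ 2 ∣ 56 := by
  haveI := isElliptic_fiftySixA1
  haveI : NeZero (56 : ℕ) := ⟨by decide⟩
  obtain ⟨f, hf⟩ := exists_isNewformOf_fiftySixA1 hnf
  obtain ⟨D⟩ := nonempty_modularParametrizationData_of_isNewformOf hf
  obtain ⟨W₀, h₀, hmin, D₀, -, hiso, hopt, -⟩ :=
    ExistsMinimalOptimalDatum.existsMinimalOptimalDatum_full (⟨0, 0, 0, 1, 2⟩ : WeierstrassCurve ℚ) D
  exact ⟨W₀, h₀, hmin, D₀, hiso, hopt, @abs_maninConstant_eq_one_fiftySix W₀ h₀ hmin D₀ hopt, EtaIdentitiesFiftySix.two_sq_dvd_fiftySix⟩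

/-- The same for the class `56b`. [cite: EdixhovenManin1991, Prop. 2] -/
theorem maninOddAtFour_domain_inhabited_fiftySixB_of_modularity (hnf : exists_isNewformOf) :
    ∃ (W₀ : WeierstrassCurve ℚ) (_ : W₀.IsElliptic) (_ : W₀.IsGloballyMinimal) (D₀ : ModularParametrizationData W₀ 56),
      (⟨0, -1, 0, 0, -4⟩ : WeierstrassCurve ℚ).IsIsogenous W₀ ∧ (∀ z ∈ D₀.L.lattice, ∃ w ∈ periodLattice D₀.f, z = D₀.c * w) ∧
      |D₀.maninConstant| = 1 := by
  haveI := isElliptic_fiftySixB1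
  haveI : NeZero (56 : ℕ) := ⟨by decide⟩
  obtain ⟨f, hf⟩ := exists_isNewformOf_fiftySixB1 hnf
  obtain ⟨D⟩ := nonempty_modularParametrizationData_of_isNewformOf hf
  obtain ⟨W₀, h₀, hmin, D₀, -, hiso, hopt, -⟩ :=
    ExistsMinimalOptimalDatum.existsMinimalOptimalDatum_full (⟨0, -1, 0, 0, -4⟩ : WeierstrassCurve ℚ) D
  exact ⟨W₀, h₀, hmin, D₀, hiso, hopt, @abs_maninConstant_eq_one_fiftySix W₀ h₀ hmin D₀ hopt⟩

end Summit.BirchSwinnertonDyer.BirchSwinnertonDyer.Theorems.ManinLocalTwoThree.NonVacuityFiftySix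

end
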